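import Literature.IUT.HodgeTheaters.GenuineFKitMergeInputsStandInNV
import Literature.IUT.HodgeTheaters.GenuineFKitOfBadLocalSlots
import Literature.IUT.HodgeTheaters.GenuineFKitOfBadLocalRealifiedOverPhi
import HarnessLib

/-!
# [IUTchI] Example 3.2 (vi)(a)(b)(c) AT THE STAND-IN MERGE RECORD modulo `hΔ` ONLY — the named record `mergeInputsStandIn`, its
# `F_{Φ^rlf}`-keyed variant, and the discharge of the binders `hH` (closed avatar) and `hY` (degenerate `Ÿ`) of `GenuineFKitOfBadLocalSlots`

S. Mochizuki, *Inter-universal Teichmüller theory I*, kurims manuscript (May 2020), Example 3.2 (vi) p. 73 («(a) `𝒟⊢_v ⊆ 𝒟_v` from `𝒟_v`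
[[AbsAnab] Lem. 1.3.8]; (b) `𝒟^Θ_v` from `𝒟_v`; (c) `𝒟⊢_v` (resp. `𝒟^Θ_v`) from `𝒞⊢_v` (resp. `𝒞^Θ_v`)»), Definition 5.2 (i)–(iv) pp. 134–135
([IUTchI] Ex 3.2 (vi) p.73) [claim: Mochizuki2012, status: disputed] (D-0012 claim key, series status DISPUTED — compositions BY NAME over landed
files; nothing of the series is asserted; no side is taken on [IUTchIII] Cor. 3.12).

PURPOSE (abc-iut-L5-lead RULINGS #123 (3): TOKEN EDIT v2.10 wants, per Ex. 3.2 sub-item at the merge, each displayed binder shown FACT-by-name /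
ORIGIN / discharged).  At the explicit R59 datum — the `X̲→`-profinite stand-in `B := badPairAtArrow hA`, merge record (m2) `m2StandIn` (abc-iut-L5-t2
★ p499559), (m1) `badTemperedSideModel` (abc-iut-L5-t3 ★ p500005), (m4) `𝒞⊩_mod`, F-0240; INHABITED by abc-iut-w4-d077 ★ p500756
`nonempty_mergeInputs_standIn` — TWO of the three anabelian binders of `ex32vi_abc_frobeniusBadAt_of_isClosed` (★ p497246) are DISCHARGED:
* `hH` — `isClosed_badPairAtArrow_H`: the stand-in's `Π_v̲ = Π_{X̲→_K} ∩ augGF⁻¹ G_v̲` is CLOSED (the image of the compact `Π_{X̲→_K} ×_{G_K} Gal(K̄_v̲/K_v̲)`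
  under the continuous first projection; §1 openness ⟸ `hA` + F-0240 + `CG`);
* `hY` — `hY_m2StandIn`: with the DEGENERATE covering `Π_Ÿ := Π_v̲` every bicontinuous automorphism carries `Π_Ÿ` to (a conjugate of) itself, trivially;
so **`ex32vi_abc_frobeniusBadAt_standIn (hΔ) : DdashFromD ∧ DThetaFromD ∧ BasesFromC`** at `frobeniusBadAt (badPairAtArrow hA) (mergeInputsStandIn …) x hx`
modulo EXACTLY `hΔ` = [AbsAnab] Lem. 1.3.8 in the unfolded shape for the GENUINE augmentation `Π_{X̲→_K} ×_{G_K} Gal(K̄_v̲/K_v̲) ↠ Gal(K̄_v̲/K_v̲)`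
(FACT F-0007-class, displayed); (vi)(c) unconditional.  Also: the named record `mergeInputsStandIn` (= the term inside ★ p500756, `rfl`), its
variant `mergeInputsStandInOverPhi` with (m4) keyed over `F_{Φ^rlf}` (★ p500041), and `nonempty_fkit_standIn` (the winning term ★ p496697 APPLIED:
the genuine `ℱ`-kit EXISTS at the stand-in kit of record).  LABEL «[MODEL datum: m2 aug genuine / `Ÿ` degenerate; m1 formal; m4 genuine]».
No instance, no notation, no `sorry`; typed ≠ inhabited ≠ proved; nothing here asserts abc proved or refuted.
-/

noncomputable section

namespace Literature.IUT.HodgeTheaters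

open Topology

variable {F K Fbar : Type} [Field F] [NumberField F] [Field K] [NumberField K] [Algebra F K]
  [Field Fbar] [Algebra F Fbar] [Algebra K Fbar] {E : WeierstrassCurve F}
  [E.IsElliptic] {l : ℕ} {Pb : BadPlacePredicates K} (D : InitialThetaData F K Fbar E l Pb)
  (hA : D.geom.pe.ArrowCoveringClaims) (CG : D.geom.pe.CuspGalois) (hTFG : D.geom.extF.GeomTFG)

namespace InitialThetaData

/-! ### The named record at the stand-in and its `F_{Φ^rlf}`-keyed variant -/

/-- **The merge record at the `X̲→`-stand-in, named** (the term of abc-iut-w4-d077 ★ p500756 / abc-iut-L5-t3 `MergeInputs.ofGroupDataModuli` at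
abc-iut-L5-t2 `m2StandIn`). «[MODEL datum, labelled]». ([IUTchI] Def 5.2 (i)-(iv) pp.134-135) [claim: Mochizuki2012, status: disputed] -/
def mergeInputsStandIn : D.MergeInputs fun v _ => D.badPairAtArrow hA v :=
  MergeInputs.ofGroupDataModuli D _
    (fun x hx =>
      haveI : Fact (D.primeAt x (D.not_mem_arc_of_mem_bad hx)).Prime := D.fact_primeAt_prime x _
      D.m2StandIn hA CG hTFG x (D.not_mem_arc_of_mem_bad hx))
    hTFG

/-- Its (m2) at a bad index IS `m2StandIn`. ([IUTchI] Ex 3.2 (i) p.70) [claim: Mochizuki2012, status: disputed] -/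
theorem mergeInputsStandIn_m2 (x : D.IndexCopy) (hx : x ∈ D.indexCopyBad) :
    (D.mergeInputsStandIn hA CG hTFG).m2 x hx =
      (haveI : Fact (D.primeAt x (D.not_mem_arc_of_mem_bad hx)).Prime := D.fact_primeAt_prime x _
       D.m2StandIn hA CG hTFG x (D.not_mem_arc_of_mem_bad hx)) := rfl

/-- The same record with (m4) keyed OVER `F_{Φ^rlf}` (★ p500041 `MergeInputs.overPhi`, the slot of record for the `⊩`-side readings).
([IUTchI] Def 5.2 (iv) p.134) [claim: Mochizuki2012, status: disputed] -/
def mergeInputsStandInOverPhi : D.MergeInputs fun v _ => D.badPairAtArrow hA v := (D.mergeInputsStandIn hA CG hTFG).overPhi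

/-- Its (m4) IS `realifiedGlobalSideOfModuliOverPhi`, its (m2) IS `m2StandIn`. ([IUTchI] Ex 3.5 (i) p.84) [claim: Mochizuki2012, status: disputed] -/
theorem mergeInputsStandInOverPhi_m4 :
    (D.mergeInputsStandInOverPhi hA CG hTFG).m4 = D.realifiedGlobalSideOfModuliOverPhi ∧
      (D.mergeInputsStandInOverPhi hA CG hTFG).m2 = (D.mergeInputsStandIn hA CG hTFG).m2 := ⟨rfl, rfl⟩

include hTFG in
/-- **The genuine `ℱ`-kit EXISTS at the stand-in kit of record** for every `hS`, `M`, `hI`, `ΛBad`, `ES` (the winning term ★ p496697 applied to the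
inhabited record). ([IUTchI] Def 5.2 (i)-(iv) pp.134-135) [claim: Mochizuki2012, status: disputed] -/
theorem nonempty_fkit_standIn (hS : D.CuspClassesNormaliserStable) [Fact l.Prime] (M : D.TorsionMonodromy)
    (hI : ∀ k ∈ D.geom.pe.inertia D.geom.pe.ε1, M.tau (D.geom.embK k) = 0)
    (ΛBad : ∀ v (h : v ∈ D.indexCopyBad), D.LocalArrowLaw CG hS (D.badPairAtArrow hA v).H)
    {Gv : D.IndexCopy → Subgroup (Fbar ≃ₐ[F] Fbar)}
    (ES : ∀ v, v ∈ D.indexCopyBad →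
      EvalSectionBinder (D.localDataOfBadPairs CG hS M hA hI (fun v _ => D.badPairAtArrow hA v) ΛBad v) (Gv v)) :
    Nonempty ((D.baseKitThetaNFOfBadPairs CG hS M hA hI (fun v _ => D.badPairAtArrow hA v) ΛBad).FKit
      (D.multKitThetaNFOfBadPairs CG hS M hA hI (fun v _ => D.badPairAtArrow hA v) ΛBad ES)) :=
  ⟨D.genuineFKitOfBadLocal CG hS M hA hI _ ΛBad ES (D.mergeInputsStandIn hA CG hTFG)⟩

/-! ### Discharging `hH` and `hY` at the stand-in -/

variable (x : D.IndexCopy) (hx : x ∈ D.indexCopyBad)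

include CG hTFG in
/-- **The stand-in's `Π_v̲ = Π_{X̲→_K} ∩ augGF⁻¹ G_v̲` is CLOSED in `Π_{C_F}`**: it is the image of the compact `Π_{X̲→_K} ×_{G_K} Gal(K̄_v̲/K_v̲)`
(`compactSpace_PiLoc_rhoAt`, §1 openness ⟸ `hA` + F-0240 + `CG`) under the continuous first projection (`range_fstLoc_rhoAt`).
([IUTchI] Def 3.1 (f) p.63) [claim: Mochizuki2012, status: disputed] -/
theorem isClosed_badPairAtArrow_H [Fact (D.primeAt x (D.not_mem_arc_of_mem_bad hx)).Prime] :
    IsClosed ((D.badPairAtArrow hA x).H : Set D.PiC) := by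
  haveI := D.compactSpace_PiLoc_rhoAt x (D.not_mem_arc_of_mem_bad hx) (D.arrowOpenClaims_pe_of_geomTFG hA hTFG CG)
  have h : ((D.badPairAtArrow hA x).H : Set D.PiC) =
      Set.range (D.fstLoc D.PiXarrow (D.rhoAt x (D.not_mem_arc_of_mem_bad hx))) := by
    rw [badPairAtArrow_H, ← D.range_fstLoc_rhoAt x (D.not_mem_arc_of_mem_bad hx), MonoidHom.coe_range]
  rw [h]
  exact (isCompact_range (D.continuous_fstLoc _ _)).isClosed

/-- **`hY` at the stand-in is TRIVIAL**: with `Π_Ÿ := Π_v̲` (degenerate covering, `m2StandIn_Y`) every bicontinuous automorphism carries `Π_Ÿ` onto a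
conjugate of itself (take `c := 1`). ([IUTchI] Ex 3.2 (ii) p.70) [claim: Mochizuki2012, status: disputed] -/
theorem hY_m2StandIn [Fact (D.primeAt x (D.not_mem_arc_of_mem_bad hx)).Prime]
    (φ : ↥(D.badPairAtArrow hA x).H ≃ₜ* ↥(D.badPairAtArrow hA x).H) :
    ∃ c : ↥(D.badPairAtArrow hA x).H, ∀ g : ↥(D.badPairAtArrow hA x).H,
      g ∈ (D.m2StandIn hA CG hTFG x (D.not_mem_arc_of_mem_bad hx)).Y ↔
        c⁻¹ * φ g * c ∈ (D.m2StandIn hA CG hTFG x (D.not_mem_arc_of_mem_bad hx)).Y :=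
  ⟨1, fun g => by simp only [m2StandIn_Y, OpenSubgroup.mem_top]⟩

/-! ### Example 3.2 (vi)(a)(b)(c) at the stand-in merge record, modulo `hΔ` only -/

/-- **[IUTchI] Ex. 3.2 (vi)(a)(b)(c) AT THE STAND-IN MERGE RECORD modulo `hΔ` ONLY** — at `frobeniusBadAt (badPairAtArrow hA) (mergeInputsStandIn …) x hx`:
(a) `𝒟⊢ ⊆ 𝒟` from `𝒟`, (b) `𝒟^Θ` from `𝒟`, (c) bases from `𝒞⊢`/`𝒞^Θ` — by ★ p497246 `ex32vi_abc_frobeniusBadAt_of_isClosed` with `hH` := `isClosed_badPairAtArrow_H`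
and `hY` := `hY_m2StandIn` DISCHARGED; displayed: `hΔ` = [AbsAnab] Lem. 1.3.8 in the unfolded shape for the GENUINE augmentation of `m2StandIn`
(FACT F-0007-class). ([IUTchI] Ex 3.2 (vi) p.73) [claim: Mochizuki2012, status: disputed] -/
theorem ex32vi_abc_frobeniusBadAt_standIn [Fact (D.primeAt x (D.not_mem_arc_of_mem_bad hx)).Prime]
    (hΔ : ∀ φ : ↥(D.badPairAtArrow hA x).H ≃ₜ* ↥(D.badPairAtArrow hA x).H,
      (D.m2StandIn hA CG hTFG x (D.not_mem_arc_of_mem_bad hx)).aug.ker.map φ.toMulEquiv.toMonoidHom =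
        (D.m2StandIn hA CG hTFG x (D.not_mem_arc_of_mem_bad hx)).aug.ker) :
    (D.frobeniusBadAt _ (D.mergeInputsStandIn hA CG hTFG) x hx).DdashFromD ∧
      (D.frobeniusBadAt _ (D.mergeInputsStandIn hA CG hTFG) x hx).DThetaFromD ∧
      (D.frobeniusBadAt _ (D.mergeInputsStandIn hA CG hTFG) x hx).BasesFromC :=
  D.ex32vi_abc_frobeniusBadAt_of_isClosed _ (D.mergeInputsStandIn hA CG hTFG) x hx
    (D.isClosed_badPairAtArrow_H hA CG hTFG x hx) hΔ (D.hY_m2StandIn hA CG hTFG x hx)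

/-- **(vi)(c) at the stand-in merge record — UNCONDITIONAL.** ([IUTchI] Ex 3.2 (vi) (c) p.73) [claim: Mochizuki2012, status: disputed] -/
theorem basesFromC_frobeniusBadAt_standIn [Fact (D.primeAt x (D.not_mem_arc_of_mem_bad hx)).Prime] :
    (D.frobeniusBadAt _ (D.mergeInputsStandIn hA CG hTFG) x hx).BasesFromC :=
  D.basesFromC_frobeniusBadAt _ (D.mergeInputsStandIn hA CG hTFG) x hx

end InitialThetaData

end Literature.IUT.HodgeTheaters

end
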